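import Summits.AtomisticToContinuum.HydrodynamicLimit.Theses.JParityClosure
import Literature.MathematicalPhysics.KineticTheory.HardSphereCampbellAssembly
import Literature.MathematicalPhysics.KineticTheory.HardSphereEulerProofs
import Literature.MathematicalPhysics.KineticTheory.MetropolisOddStatistic
import Literature.Analysis.FluidPDE.HardSphereTorusMeasure
import HarnessLib

/-!
# Cone-kernel KDE weights at an inserted contact configuration (A2 of P4)

Crux `JParityClosure.OddContactSymmetry` (stmt-AtomisticToContinuum-17722), line `KineticSlabSketch`,
registered stub `stub_kdeWeights_contactInsert` (piece A2 of the P4 assembly): elementary bounds on the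
weights

  `p k = (N+1)⁻¹ · (3/(π r³)) · max (1 − dist(x'_k, x'_i)/r) 0`

of the cone-kernel density estimate at the contact configuration `x' = contactInsert ε i j ω (xs, vs)`
(particle `i` moved to `xs j + εω`, all other particles unchanged):

1. `0 ≤ p k`;
2. `p k ≤ pmax := (N+1)⁻¹ · 3/(π r³)` (the cone profile is at most `1`);
3. the off-pair mass `Σ_{k ∉ {i, j}} p k` is at least `pmax/2 · (#{k : dist(xs k, xs j) < r/4} − 2)`:
   every `k ∉ {i, j}` within `r/4` of `xs j` is within `r/4 + ε ≤ r/2` of the inserted particle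
   `x'_i = xs j + εω` (`Torus.euclidDist_translate_le`, `ε ≤ r/4`, `‖ω‖ = 1`), where the cone profile is
   `≥ 1/2`; at most two of the near indices are `i` or `j`.
-/

noncomputable section

open scoped BigOperators Classical InnerProductSpace ENNReal Topology
open Set MeasureTheory Filter
open Literature.Analysis.FluidPDE Literature.MathematicalPhysics.KineticTheory

namespace Summit.AtomisticToContinuum.HydrodynamicLimit.Theorems.OddContactSymmetryKineticSlab

/-! ### A counting lemma -/

/-- **Off-pair mass from a pointwise lower bound.** If `p ≥ 0` on `U` and `p ≥ c ≥ 0` on a subset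
`A ⊆ U` away from the two indices `i, j`, then `Σ_{k ∈ U ∖ {i, j}} p k ≥ c · (#A − 2)`. [folklore] -/
theorem sum_sdiff_pair_ge_of_le {ι : Type*} [DecidableEq ι] (A U : Finset ι) (hAU : A ⊆ U) (i j : ι)
    {c : ℝ} (hc : 0 ≤ c) {p : ι → ℝ} (hp : ∀ k ∈ U, 0 ≤ p k)
    (hA : ∀ k ∈ A, k ≠ i → k ≠ j → c ≤ p k) :
    c * ((A.card : ℝ) - 2) ≤ ∑ k ∈ U \ {i, j}, p k := by
  have hsub : A \ {i, j} ⊆ U \ {i, j} := Finset.sdiff_subset_sdiff hAU subset_rfl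
  have hcard : (A.card : ℝ) - 2 ≤ ((A \ {i, j}).card : ℝ) := by
    have h1 : A.card - ({i, j} : Finset ι).card ≤ (A \ {i, j}).card := Finset.le_card_sdiff _ _
    have h2 : ({i, j} : Finset ι).card ≤ 2 := Finset.card_le_two
    have h3 : A.card ≤ (A \ {i, j}).card + 2 := by omega
    have h4 : (A.card : ℝ) ≤ ((A \ {i, j}).card : ℝ) + 2 := by exact_mod_cast h3
    linarith
  calc c * ((A.card : ℝ) - 2) ≤ c * ((A \ {i, j}).card : ℝ) := mul_le_mul_of_nonneg_left hcard hc
    _ = ∑ _k ∈ A \ {i, j}, c := by rw [Finset.sum_const, nsmul_eq_mul, mul_comm]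
    _ ≤ ∑ k ∈ A \ {i, j}, p k := Finset.sum_le_sum fun k hk => by
        rw [Finset.mem_sdiff, Finset.mem_insert, Finset.mem_singleton, not_or] at hk
        exact hA k hk.1 hk.2.1 hk.2.2
    _ ≤ ∑ k ∈ U \ {i, j}, p k :=
        Finset.sum_le_sum_of_subset_of_nonneg hsub fun k hk _ => hp k (Finset.sdiff_subset hk)

/-! ### The weights at an inserted contact configuration -/

/-- **A2: the KDE weights at an inserted contact configuration.** For `0 < ε < 1/2`, `0 < r`,
`ε ≤ r/4`, `i ≠ j`, a unit vector `ω` and positions/velocities `(xs, vs)`, the cone-kernel weights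
`p k = (N+1)⁻¹ (3/(π r³)) max (1 − dist(x'_k, x'_i)/r) 0` at `x' = contactInsert ε i j ω (xs, vs)`
satisfy `0 ≤ p k ≤ pmax = (N+1)⁻¹ 3/(π r³)` and
`pmax/2 · (#{k : dist(xs k, xs j) < r/4} − 2) ≤ Σ_{k ∉ {i, j}} p k`. [folklore] -/
theorem stub_kdeWeights_contactInsert :
    ∀ {N : ℕ} {ε r : ℝ} (_hε : 0 < ε) (_hε2 : ε < 1 / 2) (_hr : 0 < r) (_hεr : ε ≤ r / 4) {i j : Fin (N + 1)} (_hij : i ≠ j)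
    (ω : Metric.sphere (0 : V3) 1) (xs : Fin (N + 1) → T3) (vs : Fin (N + 1) → V3),
    (∀ k, 0 ≤ ((N : ℝ) + 1)⁻¹ * (3 / (Real.pi * r ^ 3) *
        max (1 - Torus.euclidDist ((contactInsert ε i j (ω : V3) (zipConfig (xs, vs))) k).1
          ((contactInsert ε i j (ω : V3) (zipConfig (xs, vs))) i).1 / r) 0)) ∧
    (∀ k, ((N : ℝ) + 1)⁻¹ * (3 / (Real.pi * r ^ 3) *
        max (1 - Torus.euclidDist ((contactInsert ε i j (ω : V3) (zipConfig (xs, vs))) k).1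
          ((contactInsert ε i j (ω : V3) (zipConfig (xs, vs))) i).1 / r) 0) ≤ ((N : ℝ) + 1)⁻¹ * (3 / (Real.pi * r ^ 3))) ∧
    ((N : ℝ) + 1)⁻¹ * (3 / (Real.pi * r ^ 3)) / 2 *
        (((Finset.univ.filter fun k : Fin (N + 1) => Torus.euclidDist (xs k) (xs j) < r / 4).card : ℝ) - 2) ≤
      ∑ k ∈ (Finset.univ \ {i, j}), ((N : ℝ) + 1)⁻¹ * (3 / (Real.pi * r ^ 3) *
        max (1 - Torus.euclidDist ((contactInsert ε i j (ω : V3) (zipConfig (xs, vs))) k).1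
          ((contactInsert ε i j (ω : V3) (zipConfig (xs, vs))) i).1 / r) 0) := by
  intro N ε r hε _hε2 hr hεr i j _hij ω xs vs
  set w := contactInsert ε i j (ω : V3) (zipConfig (xs, vs)) with hw_def
  -- (i) non-negativity of the weights
  have hlow : ∀ k, 0 ≤ ((N : ℝ) + 1)⁻¹ * (3 / (Real.pi * r ^ 3) *
      max (1 - Torus.euclidDist (w k).1 (w i).1 / r) 0) := fun k => by positivity
  -- (ii) the cone profile is at most `1`
  have hup : ∀ k, ((N : ℝ) + 1)⁻¹ * (3 / (Real.pi * r ^ 3) *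
      max (1 - Torus.euclidDist (w k).1 (w i).1 / r) 0) ≤ ((N : ℝ) + 1)⁻¹ * (3 / (Real.pi * r ^ 3)) := by
    intro k
    have hd : 0 ≤ Torus.euclidDist (w k).1 (w i).1 := norm_nonneg _
    have hmax : max (1 - Torus.euclidDist (w k).1 (w i).1 / r) 0 ≤ 1 :=
      max_le (by linarith [div_nonneg hd hr.le]) zero_le_one
    calc ((N : ℝ) + 1)⁻¹ * (3 / (Real.pi * r ^ 3) * max (1 - Torus.euclidDist (w k).1 (w i).1 / r) 0)
        ≤ ((N : ℝ) + 1)⁻¹ * (3 / (Real.pi * r ^ 3) * 1) := by gcongr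
      _ = ((N : ℝ) + 1)⁻¹ * (3 / (Real.pi * r ^ 3)) := by rw [mul_one]
  refine ⟨hlow, hup, ?_⟩
  -- (iii) the off-pair mass: near indices `k ∉ {i, j}` carry weight `≥ pmax / 2`
  have hpos_i : (w i).1 = xs j + Literature.Analysis.FunctionSpaces.Torus.proj (ε • (ω : V3)) := by
    rw [hw_def, contactInsert_apply_self, zipConfig_apply]
  refine sum_sdiff_pair_ge_of_le _ _ (Finset.filter_subset _ _) i j (by positivity) (fun k _ => hlow k) ?_
  intro k hk hki _hkj
  rw [Finset.mem_filter] at hk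
  have hpos_k : (w k).1 = xs k := by
    rw [hw_def, contactInsert_apply_of_ne ε j (ω : V3) _ hki, zipConfig_apply]
  -- the inserted particle is within `r/4 + ε ≤ r/2` of `xs k`
  have hdist : Torus.euclidDist (w k).1 (w i).1 ≤ r / 2 := by
    rw [hpos_k, hpos_i]
    have h := Torus.euclidDist_translate_le (xs k) (xs j) (0 : V3) (ε • (ω : V3))
    rw [Literature.Analysis.FunctionSpaces.Torus.proj_zero, add_zero, zero_sub, norm_neg, norm_smul,
      Real.norm_of_nonneg hε.le, norm_eq_of_mem_sphere ω, mul_one] at h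
    linarith [hk.2]
  have hquot : Torus.euclidDist (w k).1 (w i).1 / r ≤ 1 / 2 := by
    rw [div_le_iff₀ hr]
    linarith
  have hmax : (1 : ℝ) / 2 ≤ max (1 - Torus.euclidDist (w k).1 (w i).1 / r) 0 :=
    le_max_of_le_left (by linarith)
  calc ((N : ℝ) + 1)⁻¹ * (3 / (Real.pi * r ^ 3)) / 2 = ((N : ℝ) + 1)⁻¹ * (3 / (Real.pi * r ^ 3) * (1 / 2)) := by
        ring
    _ ≤ ((N : ℝ) + 1)⁻¹ * (3 / (Real.pi * r ^ 3) * max (1 - Torus.euclidDist (w k).1 (w i).1 / r) 0) := by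
        gcongr

end Summit.AtomisticToContinuum.HydrodynamicLimit.Theorems.OddContactSymmetryKineticSlab

end
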